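import Summits.QuantumFields.BalabanUV.T4Continuum.Support.OneStepEffectiveOperator
import Summits.QuantumFields.BalabanUV.T4Continuum.Support.ScalarBlockPlanting
import Summits.QuantumFields.BalabanUV.T4Continuum.Support.AbelianCovariantLaplacian

/-!
# T⁴ programme, spine node NE2 (U1a), tier B support row B4.d — THE ONE-STEP EFFECTIVE LAPLACIAN IS SECOND-ORDER CLOSE TO THE COARSE
# LAPLACIAN, part 1: Fourier multipliers, the spectral test extension `T = J_sp·mulOp(u⁻¹)` with `Jᴴ T = 1`, and
# `Jᴴ_sp (fine multiplier) J_sp = coarse multiplier at the central alias` (vector index; file 6a of row B4.d)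

NE2 formalisation swarm `b2b-balaban-t4-ne2-formalise-*`, seat LEAF PROVER 04, support row B4.d of `t4/formal/NE2/LEAVES.md`.
`Support/ScalarSandwichReduction.freeTowerLaws_scalar_of_excess` reduced the U = 1 scalar free-tower laws to ONE inequality, the
EFFECTIVE-LAPLACIAN EXCESS `Re⟨g, (Δ̃ − Δ)g⟩ ≤ (C/N)(⟨g, Δg⟩ + ‖Δg‖²)` (`Δ̃ = effOp Δ′ J` the one-step effective Laplacian).  By the
variational characterisation `Δ̃ ≤ TᴴΔ′T` for EVERY right inverse `T` of `Jᴴ` (`form_effOp_le_of_right_inverse` below) it suffices to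
exhibit ONE good extension.  This file builds it on the VECTOR index of the route (where the lineage's Fourier tools live; the 0-form
statement is read off through the component embedding in part 2): `T := J_sp · mulOp(u_R⁻¹)` with `J_sp = Jmat` the band-limited
(spectral) injection of `B5G183RateTorus` and `u_R = uCen` the block-averaging weight (`B5G183RateTorusW.Qavg_mul_Jmat`:
`√(R^d)·Q·J_sp = mulOp(u_R)`), so that `Jᴴ T = 1` EXACTLY for King's planting `J = √(R^d)Qᴴ`; and `Tᴴ Δ′ T = mulOp(Δ′-symbol at the
central alias / |u_R|²)` by the diagonal-conjugation identity `J_spᴴ · mulOp′(g) · J_sp = mulOp(g ∘ cen)`.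

 * §1 `form_effOp_le_of_right_inverse` (`Jᴴ T = 1 ⇒ TᴴAT − Ã = (T − E)ᴴA(T − E) ≥ 0`);
 * §2 multiplier algebra (`mulOp_mul`, `conjTranspose_mulOp`, `fdiff_eq_mulOp`, **`lap_eq_mulOp`**: the free vector Laplacian of
   `AbelianCovariantLaplacian.lap` is the multiplier with symbol `Σ_ν |fsym_ν|²`; monotonicity of real multipliers as forms);
 * §3 `cenIdx` (the central fine alias of a coarse mode), `Jhat_apply'`, **`Jmat_conjTranspose_mul_mulOp_mul_Jmat`**;
 * §4 `|u_R| ≥ (2/π)^d` (`norm_uCen_ge`), the extension `Text := Jmat · mulOp(u_R⁻¹)` and **`JKH_mul_Text : (JK)ᴴ · Text = 1`**,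
   **`conj_lap_Text : Textᴴ · lap′ · Text = mulOp(lapsym′ ∘ cen / |u_R|²)`**.

HONEST FRAMING (T4-DAG p. 1).  `U = 1`, finite torus, free (Gaussian) scalar layer written componentwise on the vector index; finite
Fourier analysis + linear algebra, statements / constants OURS ([folklore]); a SUPPORT input of row B4.b (via B4.d), NOT B4, NOT
[Balaban1985BackgroundPropagators] (3.23)–(3.26) as printed; NE2 NOT proved; NOT infinite volume / mass gap / Clay / summit progress;
spine 0/9 unchanged.  HONEST DEPENDENCY: continuum YM on T⁴ ⇐ BetaPertH ∧ nine spine estimates (0/9 proved); BetaPertH ⇐ (D1) ∧ (D4) ∧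
CAP+tail; G-an2-4 gates asym, D1 and NE2/3/4.  ABSOLUTE RULE kept; no `sorry`.
-/

noncomputable section

open scoped BigOperators ComplexConjugate ComplexOrder Matrix Matrix.Norms.L2Operator

namespace Summit.QuantumFields.BalabanUV.T4Continuum.EffectiveLaplacianSymbol

open Complex (I)
open Literature.MathematicalPhysics.QuantumFieldTheory.Balaban1983to89.B5Prop11Plancherel
open Literature.MathematicalPhysics.QuantumFieldTheory.Balaban1983to89.B4Strip (shiftr S1r Sxir S1r_eq Sxir_eq S1r_ge S1r_nonneg Sxir_nonneg)
open Literature.MathematicalPhysics.QuantumFieldTheory.Balaban1983to89.B5Prop11Fiber (dSym d1Sym vSym uSym norm_vSym_le_one norm_uSym_le_one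
  d1Sym_eq_vSym_mul norm_d1Sym_sq norm_dSym_sq)
open Literature.MathematicalPhysics.QuantumFieldTheory.Balaban1983to89.B5Prop11Lower (nsq nsq_nonneg star_dotProduct_self)
open Literature.MathematicalPhysics.QuantumFieldTheory.Balaban1983to89.B5Hk163Rate (iota iota_injective)
open Literature.MathematicalPhysics.QuantumFieldTheory.Balaban1983to89.B5G183RateTorus (Jhat Jmat Jmat_isometry Jhat_apply_emb exists_emb_eq
  blockEquiv_emb)
open Literature.MathematicalPhysics.QuantumFieldTheory.Balaban1983to89.B5G183RateTorusW (Qavg mulOp mulOp_one uCen cen Qavg_mul_Jmat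
  norm_uCen_le_one norm_uCen_sub_one_le)
open Literature.MathematicalPhysics.QuantumFieldTheory.King1986 (symmAlias symmAlias_abs_le)
open Summit.QuantumFields.BalabanUV.T4Continuum
open Summit.QuantumFields.BalabanUV.T4Continuum.OneStepEffectiveOperator
open Summit.QuantumFields.BalabanUV.T4Continuum.KingPairingPlantedLaw (JK sqrt_facts)
open Summit.QuantumFields.BalabanUV.T4Continuum.AbelianCovariantLaplacian (lap)

variable {d : ℕ}

/-! ## §1 The variational characterisation: every right inverse of `Jᴴ` bounds the effective operator from above -/

section Variational

variable {m n : Type*} [Fintype m] [Fintype n] [DecidableEq m] [DecidableEq n] {A : Matrix m m ℂ} {J : Matrix m n ℂ}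

/-- **`TᴴAT − Ã = (T − E)ᴴA(T − E)`** for every `T` with `JᴴT = 1` (Hermitian `A`). [folklore] -/
theorem conj_sub_effOp_eq (h : Admissible A J) (hA : A.IsHermitian) {T : Matrix m n ℂ} (hT : Jᴴ * T = 1) :
    Tᴴ * A * T - effOp A J = (T - extOp A J)ᴴ * A * (T - extOp A J) := by
  have hTE : Tᴴ * A * extOp A J = effOp A J := by
    rw [Matrix.mul_assoc, mul_extOp h, ← Matrix.mul_assoc, ← Matrix.conjTranspose_conjTranspose J, ← Matrix.conjTranspose_mul,
      Matrix.conjTranspose_conjTranspose, hT, Matrix.conjTranspose_one, Matrix.one_mul]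
  have hET : (extOp A J)ᴴ * A * T = effOp A J := by
    have e1 : ((extOp A J)ᴴ * A * T)ᴴ = effOp A J := by
      rw [Matrix.conjTranspose_mul, Matrix.conjTranspose_mul, Matrix.conjTranspose_conjTranspose, hA.eq, ← Matrix.mul_assoc, hTE]
    rw [← Matrix.conjTranspose_conjTranspose ((extOp A J)ᴴ * A * T), e1, (effOp_isHermitian hA).eq]
  rw [Matrix.conjTranspose_sub, Matrix.sub_mul, Matrix.sub_mul, Matrix.mul_sub, Matrix.mul_sub, hTE, hET,
    conjTranspose_extOp_mul_mul_extOp h]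
  abel

/-- **`Ã ≤ TᴴAT`** as forms, for every right inverse `T` of `Jᴴ` and `A ≥ 0`: the effective operator is the MINIMAL energy. [folklore] -/
theorem form_effOp_le_of_right_inverse (h : Admissible A J) (hA : A.PosSemidef) {T : Matrix m n ℂ} (hT : Jᴴ * T = 1) (w : n → ℂ) :
    (star w ⬝ᵥ (effOp A J *ᵥ w)).re ≤ (star w ⬝ᵥ ((Tᴴ * A * T) *ᵥ w)).re := by
  have hpsd : (Tᴴ * A * T - effOp A J).PosSemidef := by
    rw [conj_sub_effOp_eq h hA.isHermitian hT]; exact hA.conjTranspose_mul_mul_same _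
  have h1 := hpsd.re_dotProduct_nonneg w
  rw [RCLike.re_to_complex, Matrix.sub_mulVec, dotProduct_sub, Complex.sub_re] at h1
  linarith

end Variational

/-! ## §2 Fourier multipliers on the vector index -/

section Multipliers

variable (n : ℕ) [NeZero n] (M : Fin d → ℕ) [hM : ∀ μ, NeZero (M μ)]

/-- multipliers compose pointwise. [folklore] -/
theorem mulOp_mul (V W : Tor (fine n M) × Fin d → ℂ) : mulOp n M V * mulOp n M W = mulOp n M (fun i => V i * W i) := by
  have hU := dftV_mul_star (fine n M)
  unfold mulOp
  calc star (dftV (fine n M)) * Matrix.diagonal V * dftV (fine n M) * (star (dftV (fine n M)) * Matrix.diagonal W * dftV (fine n M))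
      = star (dftV (fine n M)) * Matrix.diagonal V * (dftV (fine n M) * star (dftV (fine n M))) * Matrix.diagonal W * dftV (fine n M) := by
        simp only [Matrix.mul_assoc]
    _ = star (dftV (fine n M)) * Matrix.diagonal (fun i => V i * W i) * dftV (fine n M) := by
        rw [hU, Matrix.mul_one, Matrix.mul_assoc (star (dftV (fine n M))), Matrix.diagonal_mul_diagonal]

/-- adjoint of a multiplier: conjugate symbol. [folklore] -/
theorem conjTranspose_mulOp (V : Tor (fine n M) × Fin d → ℂ) : (mulOp n M V)ᴴ = mulOp n M (star V) := by
  unfold mulOp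
  rw [Matrix.conjTranspose_mul, Matrix.conjTranspose_mul, Matrix.diagonal_conjTranspose, ← Matrix.star_eq_conjTranspose,
    ← Matrix.star_eq_conjTranspose, star_star, Matrix.mul_assoc]

/-- sums of multipliers. [folklore] -/
theorem mulOp_sum {σ : Type*} (s : Finset σ) (V : σ → Tor (fine n M) × Fin d → ℂ) :
    ∑ x ∈ s, mulOp n M (V x) = mulOp n M (fun i => ∑ x ∈ s, V x i) := by
  unfold mulOp
  rw [← Finset.sum_mul, ← Finset.mul_sum]
  congr 2
  ext i j
  simp only [Matrix.sum_apply, Matrix.diagonal_apply]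
  split_ifs <;> simp

/-- difference of multipliers. [folklore] -/
theorem mulOp_sub (V W : Tor (fine n M) × Fin d → ℂ) : mulOp n M V - mulOp n M W = mulOp n M (fun i => V i - W i) := by
  unfold mulOp
  rw [← Matrix.sub_mul, ← Matrix.mul_sub, Matrix.diagonal_sub]

/-- **the forward difference is a multiplier**: `∇^c_ν = F^* diag(fsym c ν) F`. [folklore] -/
theorem fdiff_eq_mulOp (c : ℂ) (ν : Fin d) : fdiff (fine n M) c ν = mulOp n M (fsym (fine n M) c ν) := by
  have hU := star_dftV_mul (fine n M)
  have h1 : dftV (fine n M) * fdiff (fine n M) c ν = Matrix.diagonal (fsym (fine n M) c ν) * dftV (fine n M) := by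
    rw [fdiff, Matrix.mul_smul, Matrix.mul_sub, Matrix.mul_one, dftV_mul_shiftM]
    have e : Matrix.diagonal (fsym (fine n M) c ν)
        = c • (Matrix.diagonal (fun i : Tor (fine n M) × Fin d => (ZMod.stdAddChar (N := fine n M ν)) (i.1 ν)) - 1) := by
      ext i j
      rw [Matrix.smul_apply, Matrix.sub_apply, Matrix.diagonal_apply, Matrix.diagonal_apply, Matrix.one_apply, smul_eq_mul]
      split_ifs with h
      · rw [fsym]
      · rw [sub_zero, mul_zero]
    rw [e, Matrix.smul_mul, Matrix.sub_mul, Matrix.one_mul]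
  calc fdiff (fine n M) c ν = star (dftV (fine n M)) * (dftV (fine n M) * fdiff (fine n M) c ν) := by
        rw [← Matrix.mul_assoc, hU, Matrix.one_mul]
    _ = mulOp n M (fsym (fine n M) c ν) := by rw [h1, mulOp, Matrix.mul_assoc]

/-- the symbol of the free vector Laplacian: `Σ_ν |fsym_ν|²`. [folklore] -/
def lapsym (c : ℂ) (i : Tor (fine n M) × Fin d) : ℝ := ∑ ν, ‖fsym (fine n M) c ν i‖ ^ 2

/-- `lapsym ≥ 0`. [folklore] -/
theorem lapsym_nonneg (c : ℂ) (i : Tor (fine n M) × Fin d) : 0 ≤ lapsym n M c i := Finset.sum_nonneg fun _ _ => sq_nonneg _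

/-- **`Δ = Σ_ν ∇_νᴴ∇_ν` is the multiplier with symbol `lapsym`**. [folklore] -/
theorem lap_eq_mulOp (c : ℂ) : lap (fine n M) c = mulOp n M (fun i => ((lapsym n M c i : ℝ) : ℂ)) := by
  unfold lap
  have e : ∀ ν, (fdiff (fine n M) c ν)ᴴ * fdiff (fine n M) c ν = mulOp n M (fun i => ((‖fsym (fine n M) c ν i‖ ^ 2 : ℝ) : ℂ)) := by
    intro ν
    rw [fdiff_eq_mulOp, conjTranspose_mulOp, mulOp_mul]
    congr 1; funext i
    rw [Pi.star_apply, Complex.star_def, Complex.conj_mul', Complex.ofReal_pow]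
  simp_rw [e]
  rw [mulOp_sum]
  congr 1; funext i
  rw [lapsym, Complex.ofReal_sum]

/-- the form of a multiplier with REAL symbol `f`: if `0 ≤ f` pointwise then `0 ≤ Re⟨w, mulOp f w⟩`; more generally
`f ≤ g ⇒ Re⟨w, mulOp f w⟩ ≤ Re⟨w, mulOp g w⟩`. [folklore] -/
theorem re_form_mulOp_le {f g : Tor (fine n M) × Fin d → ℝ} (hfg : ∀ i, f i ≤ g i) (w : Tor (fine n M) × Fin d → ℂ) :
    (star w ⬝ᵥ (mulOp n M (fun i => ((f i : ℝ) : ℂ)) *ᵥ w)).re ≤ (star w ⬝ᵥ (mulOp n M (fun i => ((g i : ℝ) : ℂ)) *ᵥ w)).re := by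
  have hpsd : (mulOp n M (fun i => ((g i : ℝ) : ℂ)) - mulOp n M (fun i => ((f i : ℝ) : ℂ))).PosSemidef := by
    rw [mulOp_sub]
    unfold mulOp
    have hd : (Matrix.diagonal fun i => (((g i : ℝ) : ℂ)) - ((f i : ℝ) : ℂ)).PosSemidef := by
      refine Matrix.PosSemidef.diagonal fun i => ?_
      rw [← Complex.ofReal_sub]
      exact Complex.zero_le_real.mpr (sub_nonneg.mpr (hfg i))
    have h := hd.conjTranspose_mul_mul_same (dftV (fine n M))
    rwa [← Matrix.star_eq_conjTranspose] at h
  have h1 := hpsd.re_dotProduct_nonneg w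
  rw [RCLike.re_to_complex, Matrix.sub_mulVec, dotProduct_sub, Complex.sub_re] at h1
  linarith

/-- the form of the multiplier `lapsym`: `Re⟨w, Δ w⟩ = Σ_ν nsq (∇_ν w)`. [folklore] -/
theorem re_form_lap (c : ℂ) (w : Tor (fine n M) × Fin d → ℂ) :
    (star w ⬝ᵥ (lap (fine n M) c *ᵥ w)).re = ∑ ν, nsq (fdiff (fine n M) c ν *ᵥ w) := by
  unfold lap
  rw [Matrix.sum_mulVec, dotProduct_sum, Complex.re_sum]
  refine Finset.sum_congr rfl fun ν _ => ?_
  rw [← Matrix.mulVec_mulVec, Matrix.dotProduct_mulVec, ← Matrix.star_mulVec, star_dotProduct_self, Complex.ofReal_re]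

/-- the form of `Δ²`: `Re⟨w, Δ²w⟩ = nsq (Δw)`. [folklore] -/
theorem re_form_lap_sq (c : ℝ) (w : Tor (fine n M) × Fin d → ℂ) :
    (star w ⬝ᵥ ((lap (fine n M) (c : ℂ) * lap (fine n M) (c : ℂ)) *ᵥ w)).re = nsq (lap (fine n M) (c : ℂ) *ᵥ w) := by
  have hH : (lap (fine n M) (c : ℂ)).IsHermitian := by
    unfold lap Matrix.IsHermitian
    rw [Matrix.conjTranspose_sum]
    exact Finset.sum_congr rfl fun ν _ => by rw [Matrix.conjTranspose_mul, Matrix.conjTranspose_conjTranspose]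
  rw [← Matrix.mulVec_mulVec, Matrix.dotProduct_mulVec, ← hH.eq, ← Matrix.star_mulVec, hH.eq, star_dotProduct_self, Complex.ofReal_re]

end Multipliers

/-! ## §3 The central alias of a coarse mode; diagonal conjugation by `Ĵ_R` and `J_R` -/

section Central

variable (N R : ℕ) [NeZero N] [NeZero R] (M : Fin d → ℕ) [hM : ∀ μ, NeZero (M μ)]

/-- the CENTRAL fine alias of a coarse mode: `P = (p′(q) + 2πk, μ) ↦ (p′(q) + 2πι_R k, μ)` — the level-`R·N` mode with the SAME
physical momentum (King's `m = 0` pairing, `B5Hk163Rate.iota`). [cite: King1986, (4.19) p.672] [folklore] -/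
def cenIdx (P : Tor (fine N M) × Fin d) : Tor (fine (R * N) M) × Fin d :=
  emb (R * N) M ((iota R (blockEquiv N M P).1.1 (sOf M (blockEquiv N M P).2), (blockEquiv N M P).1.2), (blockEquiv N M P).2)

/-- `cenIdx` on a coset point. [folklore] -/
theorem cenIdx_emb (k : Fin d → Fin N) (μ : Fin d) (q : Tor M) :
    cenIdx N R M (emb N M ((k, μ), q)) = emb (R * N) M ((iota R k (sOf M q), μ), q) := by
  simp only [cenIdx, blockEquiv_emb]

/-- distinct coarse modes have distinct central aliases. [folklore] -/
theorem cenIdx_injective (hN : 1 ≤ N) : Function.Injective (cenIdx N R M) := by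
  intro P P' h
  obtain ⟨⟨⟨k, μ⟩, q⟩, rfl⟩ := exists_emb_eq M N P
  obtain ⟨⟨⟨k', μ'⟩, q'⟩, rfl⟩ := exists_emb_eq M N P'
  rw [cenIdx_emb, cenIdx_emb] at h
  have h1 := emb_injective (R * N) M h
  simp only [Prod.mk.injEq] at h1
  obtain ⟨⟨hk, hμ⟩, hq⟩ := h1
  subst hq; subst hμ
  have hk' : k = k' := iota_injective (R := R) hN (abs_sOf_le M q) hk
  rw [hk']

/-- entries of `Ĵ_R`: column `P` has a single `1`, at the central alias `cenIdx P`. [folklore] -/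
theorem Jhat_apply' (P' : Tor (fine (R * N) M) × Fin d) (P : Tor (fine N M) × Fin d) :
    Jhat N R M P' P = if P' = cenIdx N R M P then 1 else 0 := by
  obtain ⟨⟨⟨k, μ⟩, q⟩, rfl⟩ := exists_emb_eq M N P
  rw [Jhat_apply_emb, cenIdx_emb]

/-- **`Ĵ_Rᴴ · diag(g) · Ĵ_R = diag(g ∘ cen)`**: conjugating a fine diagonal by the planting samples it at the central aliases. [folklore] -/
theorem Jhat_conj_diagonal (hN : 1 ≤ N) (g : Tor (fine (R * N) M) × Fin d → ℂ) :
    (Jhat N R M)ᴴ * Matrix.diagonal g * Jhat N R M = Matrix.diagonal (fun P => g (cenIdx N R M P)) := by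
  ext P P₂
  rw [Matrix.mul_assoc, Matrix.mul_apply]
  have e : ∀ P', (Jhat N R M)ᴴ P P' * (Matrix.diagonal g * Jhat N R M) P' P₂
      = if P' = cenIdx N R M P then g P' * Jhat N R M P' P₂ else 0 := by
    intro P'
    rw [Matrix.conjTranspose_apply, Matrix.diagonal_mul, Jhat_apply' N R M P' P]
    split_ifs <;> simp
  simp_rw [e]
  rw [Finset.sum_ite_eq', if_pos (Finset.mem_univ _), Jhat_apply', Matrix.diagonal_apply]
  by_cases h : P = P₂
  · subst h; rw [if_pos rfl, if_pos rfl, mul_one]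
  · rw [if_neg h, if_neg (fun h' => h (cenIdx_injective N R M hN h')), mul_zero]

/-- **`J_Rᴴ · mulOp′(g) · J_R = mulOp(g ∘ cen)`**: the spectral injection intertwines Fourier multipliers with sampling of the symbol
at the central alias. [folklore] -/
theorem Jmat_conj_mulOp (hN : 1 ≤ N) (g : Tor (fine (R * N) M) × Fin d → ℂ) :
    (Jmat N R M)ᴴ * mulOp (R * N) M g * Jmat N R M = mulOp N M (fun P => g (cenIdx N R M P)) := by
  have hU' : dftV (fine (R * N) M) * (dftV (fine (R * N) M))ᴴ = 1 := by
    rw [← Matrix.star_eq_conjTranspose]; exact dftV_mul_star (fine (R * N) M)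
  have h1 : ∀ {p : Type} [Fintype p] (X : Matrix (Tor (fine (R * N) M) × Fin d) p ℂ),
      dftV (fine (R * N) M) * ((dftV (fine (R * N) M))ᴴ * X) = X := by
    intro p _ X; rw [← Matrix.mul_assoc, hU', Matrix.one_mul]
  unfold Jmat mulOp
  rw [Matrix.star_eq_conjTranspose, Matrix.star_eq_conjTranspose, Matrix.conjTranspose_mul,
    Matrix.conjTranspose_mul, Matrix.conjTranspose_conjTranspose, ← Jhat_conj_diagonal N R M hN g]
  simp only [Matrix.mul_assoc, h1]

end Central

/-! ## §4 The averaging weight is bounded below; the spectral test extension `T = J_R · mulOp(u_R⁻¹)` -/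

section Extension

variable (N R : ℕ) [NeZero N] [NeZero R] (M : Fin d → ℕ) [hM : ∀ μ, NeZero (M μ)]

omit [NeZero N] hM in
/-- `|cen| ≤ π` (King's zone, per coarse site). [cite: King1986, (4.2) p.670] [folklore] -/
theorem abs_cen_le (hN : 1 ≤ N) (k : Fin d → Fin N) {s : Fin d → ℝ} (hs : ∀ μ, |s μ| ≤ Real.pi) (ν : Fin d) :
    |cen N k s ν| ≤ Real.pi := by
  have hNpos : (0 : ℝ) < N := by exact_mod_cast hN
  rw [cen, abs_div, abs_of_pos hNpos, div_le_iff₀ hNpos]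
  exact symmAlias_abs_le hN k hs ν

omit [NeZero N] hM in
/-- one factor of the averaging weight is bounded below: `|v_R(c)| ≥ 2/π` on `|c| ≤ π`
(`|e^{ic} − 1| ≥ (2/π)|c|` JORDAN, `|R(e^{ic/R} − 1)| ≤ |c|`). [folklore] -/
theorem norm_vSym_zero_ge {c : Fin d → ℝ} (hc : ∀ ν, |c ν| ≤ Real.pi) (ν : Fin d) : 2 / Real.pi ≤ ‖vSym R 0 c ν‖ := by
  have hπ := Real.pi_pos
  have h2π : 2 / Real.pi ≤ 1 := by rw [div_le_one hπ]; exact Real.two_le_pi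
  unfold vSym
  split_ifs with h
  · rwa [norm_one]
  · -- `‖d1Sym‖ ≥ (2/π)|c| ≥ (2/π)‖dSym‖`
    have hsh : shiftr R (0 : Fin d → Fin R) c ν = c ν := by simp [shiftr]
    have hd : ‖dSym R 0 c ν‖ ≤ |c ν| := by
      have hR : (0 : ℝ) < R := by exact_mod_cast Nat.pos_of_ne_zero (NeZero.ne R)
      rw [dSym, hsh, norm_mul, Complex.norm_natCast]
      have h1 : ‖Complex.exp (((c ν / R : ℝ) : ℂ) * I) - 1‖ ≤ |c ν / R| := by
        rw [mul_comm, ← Real.norm_eq_abs]; exact Real.norm_exp_I_mul_ofReal_sub_one_le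
      calc (R : ℝ) * ‖Complex.exp (((c ν / R : ℝ) : ℂ) * I) - 1‖ ≤ R * |c ν / R| := by gcongr
        _ = |c ν| := by rw [abs_div, Nat.abs_cast]; field_simp
    have h1 : |c ν| ≤ Real.pi / 2 * ‖d1Sym c ν‖ := by
      have hj : 4 * (c ν) ^ 2 / Real.pi ^ 2 ≤ ‖d1Sym c ν‖ ^ 2 := by
        rw [norm_d1Sym_sq]; exact S1r_ge _ (hc ν)
      have hpi2 : 0 < Real.pi ^ 2 := by positivity
      rw [div_le_iff₀ hpi2] at hj
      refine abs_le_of_sq_le_sq ?_ (by positivity)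
      nlinarith [hj, norm_nonneg (d1Sym c ν)]
    rw [norm_div, le_div_iff₀ (norm_pos_iff.mpr h)]
    calc 2 / Real.pi * ‖dSym R 0 c ν‖ ≤ 2 / Real.pi * |c ν| := by gcongr
      _ ≤ 2 / Real.pi * (Real.pi / 2 * ‖d1Sym c ν‖) := by gcongr
      _ = ‖d1Sym c ν‖ := by field_simp

/-- **`|u_R(P)| ≥ (2/π)^d`**: King's averaging weight at the central alias never vanishes. [cite: King1986, (4.3) p.670] [folklore] -/
theorem norm_uCen_ge (hN : 1 ≤ N) (P : Tor (fine N M) × Fin d) : (2 / Real.pi) ^ d ≤ ‖uCen N R M P‖ := by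
  obtain ⟨⟨⟨k, μ⟩, q⟩, rfl⟩ := exists_emb_eq M N P
  have hc : ∀ ν, |cen N k (sOf M q) ν| ≤ Real.pi := abs_cen_le N hN k (abs_sOf_le M q)
  simp only [uCen, blockEquiv_emb, uSym]
  have e : (2 / Real.pi) ^ d = ∏ _ν : Fin d, (2 / Real.pi : ℝ) := by
    rw [Finset.prod_const, Finset.card_univ, Fintype.card_fin]
  rw [norm_prod, e]
  exact Finset.prod_le_prod (fun _ _ => by positivity) fun ν _ => norm_vSym_zero_ge R hc ν

/-- `u_R(P) ≠ 0`. [folklore] -/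
theorem uCen_ne_zero (hN : 1 ≤ N) (P : Tor (fine N M) × Fin d) : uCen N R M P ≠ 0 := by
  have h := norm_uCen_ge N R M hN P
  have hpos : (0 : ℝ) < (2 / Real.pi) ^ d := by positivity
  exact norm_pos_iff.mp (lt_of_lt_of_le hpos h)

/-- **the spectral test extension** `T := J_R · mulOp(u_R⁻¹)`: band-limited interpolation, renormalised so that King's block average
of `T g` is EXACTLY `g`. [folklore] -/
def Text : Matrix (Tor (fine (R * N) M) × Fin d) (Tor (fine N M) × Fin d) ℂ :=
  Jmat N R M * mulOp N M (fun P => (uCen N R M P)⁻¹)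

/-- **`Jᴴ T = 1`** for King's planting `J = √(R^d)·Qᴴ` (`Q J_R = R^{−d/2} mulOp(u_R)`). [folklore] -/
theorem JKH_mul_Text (hN : 1 ≤ N) : (JK N R M)ᴴ * Text N R M = 1 := by
  obtain ⟨hs, -⟩ := sqrt_facts (d := d) R
  have hne : (((Real.sqrt ((R : ℝ) ^ d)) : ℝ) : ℂ) ≠ 0 := by
    have hR : (0 : ℝ) < R := by exact_mod_cast Nat.pos_of_ne_zero (NeZero.ne R)
    have : (0 : ℝ) < Real.sqrt ((R : ℝ) ^ d) := Real.sqrt_pos.mpr (by positivity)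
    exact_mod_cast this.ne'
  rw [Text, JK, Matrix.conjTranspose_smul, Matrix.conjTranspose_conjTranspose, hs, ← Matrix.mul_assoc, Matrix.smul_mul,
    Qavg_mul_Jmat, smul_smul, Complex.ofReal_inv, mul_inv_cancel₀ hne, one_smul, mulOp_mul, ← mulOp_one N M]
  congr 1
  funext P
  exact mul_inv_cancel₀ (uCen_ne_zero N R M hN P)

/-- **`Tᴴ Δ′ T = mulOp(Δ′-symbol at the central alias / |u_R|²)`**. [folklore] -/
theorem conj_lap_Text (hN : 1 ≤ N) :
    (Text N R M)ᴴ * lap (fine (R * N) M) ((R * N : ℕ) : ℂ) * Text N R M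
      = mulOp N M (fun P => (((lapsym (R * N) M ((R * N : ℕ) : ℂ) (cenIdx N R M P) / ‖uCen N R M P‖ ^ 2 : ℝ) : ℂ))) := by
  rw [Text, Matrix.conjTranspose_mul, conjTranspose_mulOp, lap_eq_mulOp]
  calc mulOp N M (star fun P => (uCen N R M P)⁻¹) * (Jmat N R M)ᴴ
        * mulOp (R * N) M (fun i => ((lapsym (R * N) M ((R * N : ℕ) : ℂ) i : ℝ) : ℂ)) * (Jmat N R M * mulOp N M fun P => (uCen N R M P)⁻¹)
      = mulOp N M (star fun P => (uCen N R M P)⁻¹)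
          * ((Jmat N R M)ᴴ * mulOp (R * N) M (fun i => ((lapsym (R * N) M ((R * N : ℕ) : ℂ) i : ℝ) : ℂ)) * Jmat N R M)
          * mulOp N M (fun P => (uCen N R M P)⁻¹) := by
        simp only [Matrix.mul_assoc]
    _ = mulOp N M (fun P => (((lapsym (R * N) M ((R * N : ℕ) : ℂ) (cenIdx N R M P) / ‖uCen N R M P‖ ^ 2 : ℝ) : ℂ))) := by
        rw [Jmat_conj_mulOp N R M hN, mulOp_mul, mulOp_mul]
        congr 1
        funext P
        have hu : (starRingEnd ℂ) (uCen N R M P)⁻¹ * (uCen N R M P)⁻¹ = (((‖uCen N R M P‖ ^ 2)⁻¹ : ℝ) : ℂ) := by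
          rw [← Complex.normSq_eq_conj_mul_self, Complex.normSq_eq_norm_sq, norm_inv, inv_pow]
        rw [Pi.star_apply, Complex.star_def, mul_right_comm, hu, div_eq_inv_mul, Complex.ofReal_mul]

end Extension

end Summit.QuantumFields.BalabanUV.T4Continuum.EffectiveLaplacianSymbol

end
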